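import Summits.PneNP.PneNP.Theorems.SymmetryBudgetNoHiddenOrderPerPathCGDecode
import Summits.PneNP.PneNP.Theorems.SymmetryBudgetNoHiddenOrderPerPathCGCount

/-!
# A decidable, relabelling-invariant admissibility for the label groups (`NoHiddenOrder`, (R2c) support)

Route `PneNP/SymmetryBudget`, `NoHiddenOrder` (stmt-PneNP-14781). The completeness theorems of the certified scheme over the components-only
Corneil–Goldberg process (`…PerPathCGRoot`, `…PerPathCGDecode`) use the admissibility predicate `BudgetBound X λ` — an `∃` over enumerations `ℕ → V`,
fine for counting (`…PerPathCGCount`) but not a predicate a circuit's LABEL TYPE can be carved out with. The symmetric compilation needs a label family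
that is FINITE, DECIDABLE and CLOSED UNDER RELABELLING, on which completeness holds and whose size is `2^{O(|V|)}`. Here it is:

* `AdmB B X λ :⇔ (λ = 0 off X) ∧ Σ_{y ∈ X} ⌊log₂ (λ y + 1)⌋ ≤ B` (decidable; the `admSet` of `…WindowCanoniserLabelsDefs` has the same shape);
* `admB_of_budgetBound` — every budgeted label is admissible for `B := 4|V| + ⌊log₂|V|⌋`, hence (`cg_root_good_dec_admB`, `cg_root_value_ptrDec_admB`,
  `cg_root_value_ptrDec_admB_refineIn`) **the scheme with admissibility `AdmB` is complete at the root** (any valuation / the realised one, any decoding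
  right on the solution subtree / the pointer-consensus decoding);
* `admB_relabel` — invariance under `Equiv.Perm V` acting by `(X, λ) ↦ (σ X, λ ∘ σ⁻¹)`;
* `mem_budgetCover_of_admB`, `card_le_of_admB` — admissible pairs lie in `budgetCover V B`, so any finite set of them has
  `≤ 2^n · (B+1) · 2^{n+B} · 2^B` elements (`n = |V|`; with `B = 4n + ⌊log₂ n⌋`: `2^{11n + O(log n)}`); `lam_lt_of_admB` bounds the values (`< 2^{B+1}`),
  so labels can be indexed by a finite function type.
-/

-- `Summit.PneNP.PneNP.…` duplicates `PneNP` BY DESIGN (single-problem summit, D-0017 layout).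
set_option linter.dupNamespace false

namespace Summit.PneNP.PneNP.Theorems

open Finset

namespace BranchSum

variable {V : Type*} [Fintype V] [DecidableEq V] {G : SimpleGraph V} [DecidableRel G.Adj] {I₀ : CGInst V}

/-! ### The predicate -/

/-- **Circuit-grade admissibility** of a label `(X, λ)` at budget `B`: the values vanish off `X` and have total bit-length at most `B`. -/
def AdmB (B : ℕ) (X : Finset V) (lam : V → ℕ) : Prop :=
  (∀ y, y ∉ X → lam y = 0) ∧ ∑ y ∈ X, Nat.log 2 (lam y + 1) ≤ B

/-- `AdmB` is decidable. -/
instance (B : ℕ) (X : Finset V) (lam : V → ℕ) : Decidable (AdmB B X lam) := by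
  unfold AdmB; infer_instance

/-- The total bit-length is the total profile of `…PerPathCGCount`. -/
theorem sum_log_eq_sum_prof (X : Finset V) (lam : V → ℕ) : ∑ y ∈ X, Nat.log 2 (lam y + 1) = ∑ y, prof X lam y := by
  unfold prof
  rw [← sum_filter, filter_mem_eq_inter, univ_inter]

/-- **Budgeted labels are admissible** for `B := 4|V| + ⌊log₂|V|⌋`. -/
theorem admB_of_budgetBound {X : Finset V} {lam : V → ℕ} (h : BudgetBound X lam) :
    AdmB (4 * Fintype.card V + Nat.log 2 (Fintype.card V)) X lam := by
  obtain ⟨t, x, d, -, hinj, hX, hlam, hsum, h0⟩ := h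
  refine ⟨h0, ?_⟩
  rw [sum_log_eq_sum_prof]
  exact sum_prof_le hinj hX hlam hsum

/-- Along the solution subtree (selector `cgSel`, values the heights, equitable start) every label is admissible. -/
theorem admB_of_reach
    (hI₀ : ∀ u ∈ I₀.1.1, ∀ u' ∈ I₀.1.1, I₀.1.2 u = I₀.1.2 u' → ∀ w ∈ I₀.1.1,
      ((cellOf I₀.1.1 I₀.1.2 w).filter fun y => G.Adj u y).card = ((cellOf I₀.1.1 I₀.1.2 w).filter fun y => G.Adj u' y).card)
    {I : (cgProcess G).Inst} {X : Finset V} {lam : V → ℕ}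
    (h : CertifiedLabels.Reach (cgProcess G) (cgSel (V := V)) (hgt G cgSel) I₀ I X lam) :
    AdmB (4 * Fintype.card V + Nat.log 2 (Fintype.card V)) X lam :=
  admB_of_budgetBound (reach_budgetBound hI₀ h)

/-! ### Invariance, values, counting -/

omit [Fintype V] [DecidableEq V] in
/-- **Relabelling invariance**: `σ · (X, λ) := (σ X, λ ∘ σ⁻¹)` is admissible iff `(X, λ)` is. -/
theorem admB_relabel (σ : Equiv.Perm V) {B : ℕ} {X : Finset V} {lam : V → ℕ} :
    AdmB B (X.map σ.toEmbedding) (lam ∘ σ.symm) ↔ AdmB B X lam := by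
  unfold AdmB
  rw [sum_map]
  simp only [Function.comp_apply, Equiv.coe_toEmbedding, Equiv.symm_apply_apply]
  refine and_congr ⟨fun h0 y hy => ?_, fun h0 y hy => ?_⟩ Iff.rfl
  · have := h0 (σ y) (by rwa [mem_map_equiv, Equiv.symm_apply_apply])
    rwa [Equiv.symm_apply_apply] at this
  · exact h0 _ fun h => hy (by rwa [mem_map_equiv])

omit [Fintype V] in
/-- Admissible values are below `2^{B+1}`. -/
theorem lam_lt_of_admB {B : ℕ} {X : Finset V} {lam : V → ℕ} (h : AdmB B X lam) (y : V) : lam y < 2 ^ (B + 1) := by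
  by_cases hy : y ∈ X
  · have h1 : Nat.log 2 (lam y + 1) ≤ B :=
      (single_le_sum (f := fun y => Nat.log 2 (lam y + 1)) (fun _ _ => Nat.zero_le _) hy).trans h.2
    have h2 : lam y + 1 < 2 ^ (Nat.log 2 (lam y + 1) + 1) := Nat.lt_pow_succ_log_self (by norm_num) _
    have h3 : 2 ^ (Nat.log 2 (lam y + 1) + 1) ≤ 2 ^ (B + 1) := Nat.pow_le_pow_right (by norm_num) (by omega)
    omega
  · rw [h.1 y hy]; exact Nat.two_pow_pos _

variable (V) in
/-- **Admissible pairs are covered** by `budgetCover V B`. -/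
theorem mem_budgetCover_of_admB {B : ℕ} {X : Finset V} {lam : V → ℕ} (h : AdmB B X lam) : (X, lam) ∈ budgetCover V B := by
  have hs : ∑ y, prof X lam y ≤ B := by rw [← sum_log_eq_sum_prof]; exact h.2
  unfold budgetCover
  rw [mem_image]
  refine ⟨(X, ⟨prof X lam, offs X lam⟩), ?_, ?_⟩
  · rw [mem_product, mem_sigma]
    refine ⟨mem_powerset.2 (subset_univ _), ?_, ?_⟩
    · unfold profiles
      rw [mem_filter, Fintype.mem_piFinset]
      refine ⟨fun y => mem_range.2 (Nat.lt_succ_of_le ?_), hs⟩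
      exact (single_le_sum (f := prof X lam) (fun _ _ => Nat.zero_le _) (mem_univ y)).trans hs
    · rw [Fintype.mem_piFinset]
      exact fun y => mem_range.2 (offs_lt X lam y)
  · simp only [decode_prof_offs h.1]

/-- **Counting admissible pairs**: any finite set of them has at most `2^n · ((B+1) · 2^{n+B}) · 2^B` elements (`n = |V|`). -/
theorem card_le_of_admB {B : ℕ} {S : Finset (Finset V × (V → ℕ))} (hS : ∀ p ∈ S, AdmB B p.1 p.2) :
    S.card ≤ 2 ^ Fintype.card V * ((B + 1) * 2 ^ (Fintype.card V + B)) * 2 ^ B :=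
  (card_le_card fun p hp => mem_budgetCover_of_admB V (hS p hp)).trans (card_budgetCover_le B)

/-! ### Completeness with admissibility `AdmB` -/

/-- **The root group outputs a good value** — any valuation, any decoding right on the solution subtree, admissibility `AdmB (4|V| + ⌊log₂|V|⌋)`,
value range `|V|`, equitable start. -/
theorem cg_root_good_dec_admB {Val : Type*} [DecidableEq Val] (Vl : CertifiedLabels.Valuation (cgProcess G) Val)
    (hI₀ : ∀ u ∈ I₀.1.1, ∀ u' ∈ I₀.1.1, I₀.1.2 u = I₀.1.2 u' → ∀ w ∈ I₀.1.1,
      ((cellOf I₀.1.1 I₀.1.2 w).filter fun y => G.Adj u y).card = ((cellOf I₀.1.1 I₀.1.2 w).filter fun y => G.Adj u' y).card)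
    (dec : CertifiedLabels.Label V → Option (CGInst V))
    (hdec : ∀ (I : CGInst V) X lam, CertifiedLabels.Reach (cgProcess G) (cgSel (V := V)) (hgt G cgSel) I₀ I X lam → dec ⟨I.1.1, X, lam⟩ = some I) :
    ∃ v : Val, CertifiedLabels.val (cgProcess G) Vl dec (fun L => AdmB (4 * Fintype.card V + Nat.log 2 (Fintype.card V)) L.X L.lam)
      (Fintype.card V) ⟨I₀.1.1, ∅, fun _ => 0⟩ = some v ∧ Vl.Good I₀ v := by
  have hne := cg_val_ne_none_of_reach_dec Vl dec hdec (fun L => AdmB (4 * Fintype.card V + Nat.log 2 (Fintype.card V)) L.X L.lam)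
    (fun I X lam h => admB_of_reach hI₀ h) I₀ ∅ (fun _ => 0) CertifiedLabels.Reach.root
  obtain ⟨v, hv⟩ := Option.ne_none_iff_exists'.1 hne
  refine ⟨v, hv, ?_⟩
  obtain ⟨I, hI, hgood⟩ := CertifiedLabels.val_sound (cgProcess G) Vl dec _ _ _ v hv
  rw [hdec I₀ ∅ (fun _ => 0) CertifiedLabels.Reach.root] at hI
  cases hI
  exact hgood

/-- **The realised scheme decoded by pointer consensus, admissibility `AdmB`, outputs a copy of the start block at the root** (fuel `≥ |V|`). -/
theorem cg_root_value_ptrDec_admB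
    (hI₀ : ∀ u ∈ I₀.1.1, ∀ u' ∈ I₀.1.1, I₀.1.2 u = I₀.1.2 u' → ∀ w ∈ I₀.1.1,
      ((cellOf I₀.1.1 I₀.1.2 w).filter fun y => G.Adj u y).card = ((cellOf I₀.1.1 I₀.1.2 w).filter fun y => G.Adj u' y).card)
    {F : ℕ} (hF : Fintype.card V ≤ F) :
    ∃ E : Enc, CertifiedLabels.val (cgProcess G) (cgValuation G) (ptrDec G I₀ F)
        (fun L => AdmB (4 * Fintype.card V + Nat.log 2 (Fintype.card V)) L.X L.lam) (Fintype.card V) ⟨I₀.1.1, ∅, fun _ => 0⟩ = some E ∧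
      ∃ l : List V, l.Nodup ∧ l.toFinset = I₀.1.1 ∧ E = encOf G I₀.1.2 l :=
  cg_root_good_dec_admB (cgValuation G) hI₀ (ptrDec G I₀ F) fun _ _ _ h => ptrDec_reach h hF

/-- The same from a block `W` with the refinement of a start colouring `λ₀` (window: `V` the window type, `W = univ`, `λ₀` the signature ranks). -/
theorem cg_root_value_ptrDec_admB_refineIn {W : Finset V} (hW : W.Nonempty) (lam₀ : V → ℕ) {F : ℕ} (hF : Fintype.card V ≤ F) :
    ∃ E : Enc, CertifiedLabels.val (cgProcess G) (cgValuation G) (ptrDec G ⟨(W, refineIn G W lam₀), hW⟩ F)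
        (fun L => AdmB (4 * Fintype.card V + Nat.log 2 (Fintype.card V)) L.X L.lam) (Fintype.card V) ⟨W, ∅, fun _ => 0⟩ = some E ∧
      ∃ l : List V, l.Nodup ∧ l.toFinset = W ∧ E = encOf G (refineIn G W lam₀) l :=
  cg_root_value_ptrDec_admB (I₀ := ⟨(W, refineIn G W lam₀), hW⟩) (fun _ hu _ hu' huu' _ hw => equitableIn_refineIn W lam₀ hu hu' huu' hw) hF

end BranchSum

end Summit.PneNP.PneNP.Theorems
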